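import Literature.NumberTheory.Automorphic.UnramifiedPureTensorStarCharacter
import Literature.NumberTheory.Automorphic.LocalUnitaryGroupCongrMeasure
import HarnessLib

/-!
# The 𝔠₀ instance of the sockets `Unr S` ∕ `hat` of the classification kit: unramified pure tensors off `S` and `f^S ↦ f^{S∧}(t) = ∏_{v∈T} t_v(f_v)`

Cell `hodgecm-mathlib`, F0∕P3 «U3-mult», crux H413 (`stmt-HodgeConjecture-24833`), RUNG 4 integrator (T5 `F0_T5InnerFormClassification`, RULINGS (V21)∕(V22):
the kit KEEPS the posited sockets `Unr : Finset Places → Type`, `hat : ∀ S, Germ S → Unr S → ℂ` with pins (vii) FACTORISATION and (viii) RICHNESS; THIS FILE is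
their ED. 4 INSTANCE); F0P4-p08 (g6) for the F0∕P3 desk.  Kit-free (imports no `Lines/`, no T5 module): `--supports stmt-HodgeConjecture-24833`.

* `UnrTensor L H S` — an UNRAMIFIED PURE TENSOR OFF `S` [Rogawski1990 §13.7 p. 206 «`f ∈ ⊗_{v∉S} 𝓗_v`»; CartierCorvallis1979 §IV.1; Flath1979 §2]: local factors
  `f_v ∈ C_c(K_v\G′_v/K_v)` (`G′_v = (cmDatum L 3 H).Local v`, `K_v = cmLocalIntegralLevel L 3 H v`; ★ `LocalUnitaryGroupCongrMeasure` for its topology) equal to `𝟙_{K_v}` off a declared finite `T`, `T ∩ S = ∅`.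
* `UnrTensor.hatOf t F := ∏_{v ∈ F.T} t_v(f_v)` at a family of local functionals `t` (an e.v.p. representative); `hatOf_congr` — it only depends on `t` off `S`,
  so at ED. 4 `hat S g F := Quotient.liftOn g (hatOf · F) …` on germs; `hatOf_eq_of_loc_eq` — PADDING INVARIANCE at e.v.p.'s with `t_v(𝟙_{K_v}) = 1`.
* PINS (vii)(viii) FOR THIS INSTANCE, `rfl`-grade: `factorises` and `rich`.
* The unital `*`-algebra structure realised on tensors: `unit`, `single` (+ `hatOf_unit`, `hatOf_single`), `star` (+ `hatOf_star`: `= conj` at eigencharacters of admissible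
  unitarizable spherical classes, ★ p817782 `prod_apply_mulStar`) and `mul μv` (normalised placewise convolution; + `hatOf_mul`: `= hatOf t F * hatOf t G` at eigencharacters
  of admissible spherical classes, ★ p817782 `prod_apply_inv_smul_mulConv`).  Pin (iii′) (`vol K_v = 1`) is NOT needed: `μ_v(K_v) ≠ 0` for any Haar measure on the
  compact open `K_v` (`measureReal_cmLocalIntegralLevel_ne_zero`).

References: [Rogawski1990] §13.7 p. 206; [CartierCorvallis1979] §IV.1; [Flath1979] §2.  HC_CM is proved only modulo the printed citations until rung 0 closes.
-/

set_option autoImplicit false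
-- project-wide idiom for `Summit.HodgeConjecture.HodgeConjecture.…` (summit = problem name): the namespace IS duplicated
set_option linter.dupNamespace false

noncomputable section

open MeasureTheory NumberField IsDedekindDomain Literature.NumberTheory.Automorphic Literature.NumberTheory.Automorphic.UnitaryGroup
open scoped ComplexConjugate Classical

namespace Summit.HodgeConjecture.HodgeConjecture.Cruxes.H413.F0P3UnrTensorInstance

variable (L : Type) [Field L] [NumberField L] [IsCMField L] (H : Matrix (Fin 3) (Fin 3) L)

/-- **UNRAMIFIED PURE TENSORS OFF `S`**: families of local factors `f_v ∈ C_c(K_v\G′_v/K_v)`, equal to the unit `𝟙_{K_v}` off a declared finite set `T` disjoint from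
`S` [Rogawski1990 §13.7 p. 206; CartierCorvallis1979 §IV.1; Flath1979 §2]. -/
structure UnrTensor (S : Finset (HeightOneSpectrum (𝓞 ↥(maximalRealSubfield L)))) : Type where
  /-- the declared finite support (a bound: `loc v = 𝟙_{K_v}` off `T`) -/
  T : Finset (HeightOneSpectrum (𝓞 ↥(maximalRealSubfield L)))
  /-- the support avoids `S` -/
  hT : Disjoint T S
  /-- the local factors `f_v : G′_v → ℂ` -/
  loc : ∀ v : HeightOneSpectrum (𝓞 ↥(maximalRealSubfield L)), (cmDatum L 3 H).Local v → ℂ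
  /-- each local factor is compactly supported -/
  hcs : ∀ v, HasCompactSupport (loc v)
  /-- each local factor is bi-`K_v`-invariant, `K_v = U(H)(𝒪_v)` -/
  hlev : ∀ v, IsLevel (cmLocalIntegralLevel L 3 H v) (loc v)
  /-- off `T` the local factor is the unit `𝟙_{K_v}` -/
  loc_eq : ∀ v, v ∉ T → loc v = (cmLocalIntegralLevel L 3 H v : Set ((cmDatum L 3 H).Local v)).indicator fun _ => (1 : ℂ)

namespace UnrTensor

variable {L H} {S : Finset (HeightOneSpectrum (𝓞 ↥(maximalRealSubfield L)))}

/-- `K_v` is compact and open (★ `isCompact_isOpen_cmLocalIntegralLevel`), as a pair of facts used throughout. -/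
private theorem hK (v : HeightOneSpectrum (𝓞 ↥(maximalRealSubfield L))) :
    IsCompact (cmLocalIntegralLevel L 3 H v : Set ((cmDatum L 3 H).Local v)) ∧ IsOpen (cmLocalIntegralLevel L 3 H v : Set ((cmDatum L 3 H).Local v)) :=
  isCompact_isOpen_cmLocalIntegralLevel L 3 H v

/-- **`f^{S∧}(t) = ∏_{v ∈ T} t_v(f_v)`** at a family `t` of local functionals (a representative of an e.v.p. germ) [Rogawski1990 §13.7 p. 206]. -/
def hatOf (t : ∀ v : HeightOneSpectrum (𝓞 ↥(maximalRealSubfield L)), ((cmDatum L 3 H).Local v → ℂ) → ℂ) (F : UnrTensor L H S) : ℂ :=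
  ∏ v ∈ F.T, t v (F.loc v)

/-- Unfolding `hatOf`. -/
theorem hatOf_def (t : ∀ v : HeightOneSpectrum (𝓞 ↥(maximalRealSubfield L)), ((cmDatum L 3 H).Local v → ℂ) → ℂ) (F : UnrTensor L H S) :
    hatOf t F = ∏ v ∈ F.T, t v (F.loc v) := rfl

/-- **`hatOf` only sees `t` OFF `S`** (`T ∩ S = ∅`): the socket `hat S g F := Quotient.liftOn g (hatOf · F) (hatOf_congr …)` is well defined on germs off `S`. -/
theorem hatOf_congr {t t' : ∀ v : HeightOneSpectrum (𝓞 ↥(maximalRealSubfield L)), ((cmDatum L 3 H).Local v → ℂ) → ℂ}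
    (h : ∀ v, v ∉ S → t v = t' v) (F : UnrTensor L H S) : hatOf t F = hatOf t' F :=
  Finset.prod_congr rfl fun v hv => by rw [h v (Finset.disjoint_left.1 F.hT hv)]

/-- **PIN (vii) FACTORISATION for this instance** (`rfl`-grade): the declared support and the local factors. -/
theorem factorises (F : UnrTensor L H S) :
    ∃ T : Finset (HeightOneSpectrum (𝓞 ↥(maximalRealSubfield L))), Disjoint T S ∧
      ∃ f : ∀ v : HeightOneSpectrum (𝓞 ↥(maximalRealSubfield L)), (cmDatum L 3 H).Local v → ℂ,
        (∀ v ∈ T, HasCompactSupport (f v) ∧ IsLevel (cmLocalIntegralLevel L 3 H v) (f v)) ∧ ∀ t, hatOf t F = ∏ v ∈ T, t v (f v) :=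
  ⟨F.T, F.hT, F.loc, fun v _ => ⟨F.hcs v, F.hlev v⟩, fun _ => rfl⟩

/-- **The tensor carrying a finite family off `S`**, padded by `𝟙_{K_v}` (the witness of pin (viii)). -/
def ofFamily (T : Finset (HeightOneSpectrum (𝓞 ↥(maximalRealSubfield L)))) (hT : Disjoint T S)
    (f : ∀ v : HeightOneSpectrum (𝓞 ↥(maximalRealSubfield L)), (cmDatum L 3 H).Local v → ℂ)
    (hf : ∀ v ∈ T, HasCompactSupport (f v) ∧ IsLevel (cmLocalIntegralLevel L 3 H v) (f v)) : UnrTensor L H S where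
  T := T
  hT := hT
  loc v := if v ∈ T then f v else (cmLocalIntegralLevel L 3 H v : Set ((cmDatum L 3 H).Local v)).indicator fun _ => (1 : ℂ)
  hcs v := by
    by_cases hv : v ∈ T
    · simp only [hv, ↓reduceIte]; exact (hf v hv).1
    · simp only [hv, ↓reduceIte]; exact (indicator_mem_schwartzBruhat (hK v).2 (hK v).1).2
  hlev v := by
    by_cases hv : v ∈ T
    · simp only [hv, ↓reduceIte]; exact (hf v hv).2
    · simp only [hv, ↓reduceIte]; exact IsLevel.indicator (hK v).2 (hK v).1
  loc_eq v hv := by simp only [hv, ↓reduceIte]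

/-- The local factors of `ofFamily` on the declared support. -/
@[simp] theorem ofFamily_loc_of_mem {T : Finset (HeightOneSpectrum (𝓞 ↥(maximalRealSubfield L)))} (hT : Disjoint T S)
    {f : ∀ v : HeightOneSpectrum (𝓞 ↥(maximalRealSubfield L)), (cmDatum L 3 H).Local v → ℂ}
    (hf : ∀ v ∈ T, HasCompactSupport (f v) ∧ IsLevel (cmLocalIntegralLevel L 3 H v) (f v)) {v : HeightOneSpectrum (𝓞 ↥(maximalRealSubfield L))}
    (hv : v ∈ T) : (ofFamily T hT f hf : UnrTensor L H S).loc v = f v :=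
  if_pos hv

/-- `hatOf t (ofFamily T f) = ∏_{v ∈ T} t_v(f_v)`. -/
theorem hatOf_ofFamily (t : ∀ v : HeightOneSpectrum (𝓞 ↥(maximalRealSubfield L)), ((cmDatum L 3 H).Local v → ℂ) → ℂ)
    (T : Finset (HeightOneSpectrum (𝓞 ↥(maximalRealSubfield L)))) (hT : Disjoint T S)
    (f : ∀ v : HeightOneSpectrum (𝓞 ↥(maximalRealSubfield L)), (cmDatum L 3 H).Local v → ℂ)
    (hf : ∀ v ∈ T, HasCompactSupport (f v) ∧ IsLevel (cmLocalIntegralLevel L 3 H v) (f v)) :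
    hatOf t (ofFamily T hT f hf : UnrTensor L H S) = ∏ v ∈ T, t v (f v) :=
  Finset.prod_congr rfl fun v hv => by rw [ofFamily_loc_of_mem hT hf hv]

/-- **PIN (viii) RICHNESS for this instance**: every finite family of spherical Hecke functions off `S` is carried by a tensor. -/
theorem rich (T : Finset (HeightOneSpectrum (𝓞 ↥(maximalRealSubfield L)))) (hT : Disjoint T S)
    (f : ∀ v : HeightOneSpectrum (𝓞 ↥(maximalRealSubfield L)), (cmDatum L 3 H).Local v → ℂ)
    (hf : ∀ v ∈ T, HasCompactSupport (f v) ∧ IsLevel (cmLocalIntegralLevel L 3 H v) (f v)) :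
    ∃ F : UnrTensor L H S, ∀ t, hatOf t F = ∏ v ∈ T, t v (f v) :=
  ⟨ofFamily T hT f hf, fun t => hatOf_ofFamily t T hT f hf⟩

/-- **The unit** `𝟙 = ⊗_v 𝟙_{K_v}` (declared support `∅`). -/
def unit : UnrTensor L H S where
  T := ∅
  hT := Finset.disjoint_empty_left S
  loc v := (cmLocalIntegralLevel L 3 H v : Set ((cmDatum L 3 H).Local v)).indicator fun _ => (1 : ℂ)
  hcs v := (indicator_mem_schwartzBruhat (hK v).2 (hK v).1).2
  hlev v := IsLevel.indicator (hK v).2 (hK v).1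
  loc_eq _ _ := rfl

/-- `hatOf t 𝟙 = 1` for EVERY `t` (empty product; no pin). -/
@[simp] theorem hatOf_unit (t : ∀ v : HeightOneSpectrum (𝓞 ↥(maximalRealSubfield L)), ((cmDatum L 3 H).Local v → ℂ) → ℂ) :
    hatOf t (unit : UnrTensor L H S) = 1 :=
  Finset.prod_empty

/-- **Single-place families** `𝟙 ⊗ ⋯ ⊗ f_v ⊗ ⋯ ⊗ 𝟙` (`v ∉ S`) — the probes of (L1-i). -/
def single (v : HeightOneSpectrum (𝓞 ↥(maximalRealSubfield L))) (hv : v ∉ S) (f : (cmDatum L 3 H).Local v → ℂ) (hf : HasCompactSupport f)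
    (hKf : IsLevel (cmLocalIntegralLevel L 3 H v) f) : UnrTensor L H S :=
  ofFamily {v} (Finset.disjoint_singleton_left.2 hv) (fun w => if h : w = v then h ▸ f else 0) fun w hw => by
    rw [Finset.mem_singleton] at hw
    subst hw
    simpa using And.intro hf hKf

/-- `hatOf t (single v f) = t_v(f)`. -/
@[simp] theorem hatOf_single (t : ∀ v : HeightOneSpectrum (𝓞 ↥(maximalRealSubfield L)), ((cmDatum L 3 H).Local v → ℂ) → ℂ)
    (v : HeightOneSpectrum (𝓞 ↥(maximalRealSubfield L))) (hv : v ∉ S) (f : (cmDatum L 3 H).Local v → ℂ) (hf : HasCompactSupport f)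
    (hKf : IsLevel (cmLocalIntegralLevel L 3 H v) f) : hatOf t (single v hv f hf hKf : UnrTensor L H S) = t v f := by
  rw [single, hatOf_ofFamily, Finset.prod_singleton]
  simp

/-- **PADDING INVARIANCE**: two tensors with THE SAME local factors (possibly different declared supports) have the same `hatOf t` at every family `t` with
`t_v(𝟙_{K_v}) = 1` off `S` — e.g. the e.v.p.'s of spherical classes (★ `IsSphericalWith.apply_indicator_eq_one`). -/
theorem hatOf_eq_of_loc_eq (t : ∀ v : HeightOneSpectrum (𝓞 ↥(maximalRealSubfield L)), ((cmDatum L 3 H).Local v → ℂ) → ℂ)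
    (hone : ∀ v, v ∉ S → t v ((cmLocalIntegralLevel L 3 H v : Set ((cmDatum L 3 H).Local v)).indicator fun _ => (1 : ℂ)) = 1)
    {F F' : UnrTensor L H S} (h : F.loc = F'.loc) : hatOf t F = hatOf t F' := by
  classical
  have aux : ∀ (A B : Finset (HeightOneSpectrum (𝓞 ↥(maximalRealSubfield L))))
      (loc : ∀ v : HeightOneSpectrum (𝓞 ↥(maximalRealSubfield L)), (cmDatum L 3 H).Local v → ℂ), Disjoint B S →
      (∀ v, v ∉ A → loc v = (cmLocalIntegralLevel L 3 H v : Set ((cmDatum L 3 H).Local v)).indicator fun _ => (1 : ℂ)) →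
      ∏ v ∈ A, t v (loc v) = ∏ v ∈ A ∪ B, t v (loc v) := by
    intro A B loc hB hA
    refine Finset.prod_subset Finset.subset_union_left fun v hv hvA => ?_
    have hvB : v ∈ B := (Finset.mem_union.1 hv).resolve_left hvA
    rw [hA v hvA, hone v (Finset.disjoint_left.1 hB hvB)]
  rw [hatOf_def, hatOf_def, aux F.T F'.T F.loc F'.hT F.loc_eq, aux F'.T F.T F'.loc F.hT F'.loc_eq, h, Finset.union_comm]

/-- **The involution** `F ↦ F^* = (f_v^*)_v` (`𝟙_{K_v}^* = 𝟙_{K_v}`, ★ `mulStar_indicator_subgroup`). -/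
def star (F : UnrTensor L H S) : UnrTensor L H S where
  T := F.T
  hT := F.hT
  loc v := mulStar (F.loc v)
  hcs v := hasCompactSupport_mulStar (F.hcs v)
  hlev v := (F.hlev v).mulStar
  loc_eq v hv := by rw [F.loc_eq v hv, mulStar_indicator_subgroup]

section Measure

variable (μv : ∀ v : HeightOneSpectrum (𝓞 ↥(maximalRealSubfield L)), @Measure ((cmDatum L 3 H).Local v) (borel _))

/-- `μ_v(K_v) ≠ 0` (as a real number) for a Haar measure `μ_v`: `K_v` is compact open.  (So the normalisation `vol K_v = 1` is never needed below.) -/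
theorem measureReal_cmLocalIntegralLevel_ne_zero (v : HeightOneSpectrum (𝓞 ↥(maximalRealSubfield L)))
    (hμ : letI : MeasurableSpace ((cmDatum L 3 H).Local v) := borel _; (μv v).IsHaarMeasure) :
    letI : MeasurableSpace ((cmDatum L 3 H).Local v) := borel _
    (μv v).real (cmLocalIntegralLevel L 3 H v : Set ((cmDatum L 3 H).Local v)) ≠ 0 := by
  letI : MeasurableSpace ((cmDatum L 3 H).Local v) := borel _
  haveI : BorelSpace ((cmDatum L 3 H).Local v) := ⟨rfl⟩
  haveI := hμ
  rw [measureReal_def, ENNReal.toReal_ne_zero]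
  exact ⟨((hK v).2.measure_pos (μv v) ⟨1, (cmLocalIntegralLevel L 3 H v).one_mem⟩).ne', (hK v).1.measure_lt_top.ne⟩

/-- **The product** `F ⋆ G := (μ_v(K_v)⁻¹ • (f_v ⋆ g_v))_{v ∈ T_F ∪ T_G}`, `𝟙` elsewhere (placewise convolution normalised by `μ_v(K_v)`; ★ `IsLevel.mulConv`). -/
def mul (hμ : ∀ v, letI : MeasurableSpace ((cmDatum L 3 H).Local v) := borel _; (μv v).IsMulLeftInvariant) (F G : UnrTensor L H S) :
    UnrTensor L H S :=
  letI : ∀ v, MeasurableSpace ((cmDatum L 3 H).Local v) := fun _ => borel _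
  haveI : ∀ v, BorelSpace ((cmDatum L 3 H).Local v) := fun _ => ⟨rfl⟩
  ofFamily (F.T ∪ G.T) (Finset.disjoint_union_left.2 ⟨F.hT, G.hT⟩)
    (fun v => (((μv v).real (cmLocalIntegralLevel L 3 H v : Set ((cmDatum L 3 H).Local v)) : ℂ)⁻¹) • mulConv (μv v) (F.loc v) (G.loc v))
    fun v _ =>
      haveI := hμ v
      ⟨(hasCompactSupport_mulConv (μv v) (F.hcs v) (G.hcs v)).smul_left
          (f := fun _ => (((μv v).real (cmLocalIntegralLevel L 3 H v : Set ((cmDatum L 3 H).Local v)) : ℂ)⁻¹)),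
        ((F.hlev v).mulConv (μv v) (G.hlev v)).smul _⟩

/-- **`hatOf t (F ⋆ G) = hatOf t F · hatOf t G`** at every family `t` which is, placewise off `S`, the eigencharacter of an ADMISSIBLE `K_v`-SPHERICAL class (★ p817782
`prod_apply_inv_smul_mulConv`; `μ_v` Haar) [CartierCorvallis1979 §IV.1 Cor. 4.1; Rogawski1990 §13.7 p. 206]. -/
theorem hatOf_mul (hμ : ∀ v, letI : MeasurableSpace ((cmDatum L 3 H).Local v) := borel _; (μv v).IsHaarMeasure) (F G : UnrTensor L H S)
    (t : ∀ v : HeightOneSpectrum (𝓞 ↥(maximalRealSubfield L)), ((cmDatum L 3 H).Local v → ℂ) → ℂ)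
    (c : ∀ v : HeightOneSpectrum (𝓞 ↥(maximalRealSubfield L)), IrrClass ((cmDatum L 3 H).Local v))
    (hc : ∀ v, v ∉ S → letI : MeasurableSpace ((cmDatum L 3 H).Local v) := borel _
      (c v).IsAdmissible ∧ (c v).IsSphericalWith (cmLocalIntegralLevel L 3 H v) (μv v) (t v)) :
    hatOf t (mul μv (fun v => letI : MeasurableSpace ((cmDatum L 3 H).Local v) := borel _; (hμ v).toIsMulLeftInvariant) F G) =
      hatOf t F * hatOf t G := by
  letI : ∀ v, MeasurableSpace ((cmDatum L 3 H).Local v) := fun v => borel _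
  haveI : ∀ v, BorelSpace ((cmDatum L 3 H).Local v) := fun v => ⟨rfl⟩
  haveI : ∀ v, (μv v).IsHaarMeasure := hμ
  classical
  have hμK := fun v => measureReal_cmLocalIntegralLevel_ne_zero μv v (hμ v)
  have hS : ∀ v, v ∈ F.T ∪ G.T → v ∉ S := fun v hv => by
    rcases Finset.mem_union.1 hv with h | h
    · exact Finset.disjoint_left.1 F.hT h
    · exact Finset.disjoint_left.1 G.hT h
  rw [mul, hatOf_ofFamily, hatOf_def, hatOf_def]
  exact IrrClass.prod_apply_inv_smul_mulConv (fun v => cmLocalIntegralLevel L 3 H v) μv (fun v hv => (hc v (hS v hv)).1)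
    (fun v hv => (hc v (hS v hv)).2) (fun v => (hK v).2) (fun v => (hK v).1) hμK F.hcs F.hlev G.hcs G.hlev F.loc_eq G.loc_eq

/-- **`hatOf t F^* = \overline{hatOf t F}`** at every family `t` which is, placewise off `S`, the eigencharacter of an ADMISSIBLE UNITARIZABLE `K_v`-SPHERICAL class, for
inversion-invariant Haar measures (unimodular `U(H)(L⁺_v)`; ★ p817782 `prod_apply_mulStar`) [CartierCorvallis1979 §IV.1; DeitmarEchterhoff2014 Prop. 6.2.1]. -/
theorem hatOf_star (hμ : ∀ v, letI : MeasurableSpace ((cmDatum L 3 H).Local v) := borel _; (μv v).IsHaarMeasure)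
    (hinv : ∀ v, letI : MeasurableSpace ((cmDatum L 3 H).Local v) := borel _; (μv v).IsInvInvariant) (F : UnrTensor L H S)
    (t : ∀ v : HeightOneSpectrum (𝓞 ↥(maximalRealSubfield L)), ((cmDatum L 3 H).Local v → ℂ) → ℂ)
    (c : ∀ v : HeightOneSpectrum (𝓞 ↥(maximalRealSubfield L)), IrrClass ((cmDatum L 3 H).Local v))
    (hc : ∀ v, v ∉ S → letI : MeasurableSpace ((cmDatum L 3 H).Local v) := borel _
      (c v).IsAdmissible ∧ (c v).IsUnitarizable ∧ (c v).IsSphericalWith (cmLocalIntegralLevel L 3 H v) (μv v) (t v)) :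
    hatOf t (star F) = conj (hatOf t F) := by
  letI : ∀ v, MeasurableSpace ((cmDatum L 3 H).Local v) := fun v => borel _
  haveI : ∀ v, BorelSpace ((cmDatum L 3 H).Local v) := fun v => ⟨rfl⟩
  haveI : ∀ v, (μv v).IsHaarMeasure := hμ
  haveI : ∀ v, (μv v).IsInvInvariant := hinv
  have hμK := fun v => measureReal_cmLocalIntegralLevel_ne_zero μv v (hμ v)
  have hS : ∀ v, v ∈ F.T → v ∉ S := fun v hv => Finset.disjoint_left.1 F.hT hv
  rw [hatOf_def, hatOf_def]
  exact IrrClass.prod_apply_mulStar (fun v => cmLocalIntegralLevel L 3 H v) μv F.T (fun v hv => (hc v (hS v hv)).1)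
    (fun v hv => (hc v (hS v hv)).2.1) (fun v hv => (hc v (hS v hv)).2.2) hμK F.hcs F.hlev

end Measure

end UnrTensor

end Summit.HodgeConjecture.HodgeConjecture.Cruxes.H413.F0P3UnrTensorInstance

end
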